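import Summits.Ventures.Crystal3D.Theorems.StickyWulffConstantNoReconstructionGainFourFamilyFilm
import Summits.Ventures.Crystal3D.Theorems.StickyWulffConstantNoReconstructionGainSlabOrbit
import HarnessLib

/-!
# Films on `(1/3)Λ₀`: every cone of normals (transport by lattice isometries)

HONEST FRAMING. Part of the venture `Summits/Ventures/Crystal3D` (cell `crystal3d-full`), helper
`--supports` the crux `NoReconstructionGain` (stmt-Ventures-19144, route
`route-Ventures-StickyWulffConstant`), line `adhesion`; continuation of `…FourFamilyFilm` (class (ii)).

The refined lattice `(1/3)Λ₀` is invariant under every linear isometry `g` with `g Λ₀ = Λ₀`, so the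
four-family rung transports verbatim: pull the configuration back by `g`; the cone condition becomes
`⟪g hᵢ, ν⟫ ≤ 0` for the six heads.  The 48 lattice isometries of the cube group carry the fundamental
cone `a₁ ≥ a₂ ≥ |a₃|` onto all of the sphere, so every unit normal is covered by some `g`.

* `fourFamily_transport` — the transport lemma for the film class `(1/3)Λ₀` and a normal predicate;
* `fourFamilyBarlowFilm_slab_orbit` (**rung**, registered by name): for every lattice isometry `g`
  and every unit `ν` with `⟪g hᵢ, ν⟫ ≤ 0` (`i = 1..6`): films in `(1/3)Λ₀` above the cut satisfy the
  atom in slab form (`R = 2`, `C = 18432`).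

WHAT THIS IS NOT: an explicit list of the 48 isometries / the covering statement; off-lattice films;
rung F-C1 not moved.
-/

noncomputable section

namespace Summit.Ventures.Crystal3D.Theorems

open Summit.Ventures.Crystal3D Finset
open Literature.MathematicalPhysics.StatisticalMechanics (barlowPos fccStacking barlowOffset layerNormal constHagg
  mem_barlowStacking_iff contactDeficiency)
open scoped InnerProductSpace

/-- Transport of a slab-form rung for films in `(1/3)Λ₀` under a lattice isometry `g`. -/
theorem fourFamily_transport (Reg : EuclideanSpace ℝ (Fin 3) → Prop)
    (hT : ∃ R C : ℝ, 1 ≤ R ∧ ∀ ν : EuclideanSpace ℝ (Fin 3), ‖ν‖ = 1 → ∀ ρ : ℝ, R ≤ ρ →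
      ∀ X P : Finset (EuclideanSpace ℝ (Fin 3)),
      (∀ p ∈ X, ∀ q ∈ X, p ≠ q → 1 ≤ dist p q) → P ⊆ X →
      (∀ p, p ∈ P ↔ (p ∈ fccStacking 1 (Real.sqrt (2 / 3)) ∧ -(2 * R) ≤ ⟪p, ν⟫_ℝ ∧
        ⟪p, ν⟫_ℝ ≤ -R ∧ ‖p‖ ^ 2 - ⟪p, ν⟫_ℝ ^ 2 ≤ ρ ^ 2)) →
      Reg ν →
      (∀ q ∈ X \ P, ∃ K I J : ℤ, q = (1 / 3 : ℝ) • barlowPos 1 (Real.sqrt (2 / 3)) constHagg K I J) →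
      (∀ q ∈ X \ P, -R < ⟪q, ν⟫_ℝ) →
      ((((P ×ˢ (X \ P)).filter fun pq => dist pq.1 pq.2 = 1).card : ℕ) : ℝ) ≤
        contactDeficiency (X \ P) + C * ρ) :
    ∃ R C : ℝ, 1 ≤ R ∧ ∀ ν : EuclideanSpace ℝ (Fin 3), ‖ν‖ = 1 → ∀ ρ : ℝ, R ≤ ρ →
      ∀ X P : Finset (EuclideanSpace ℝ (Fin 3)),
      (∀ p ∈ X, ∀ q ∈ X, p ≠ q → 1 ≤ dist p q) → P ⊆ X →
      (∀ p, p ∈ P ↔ (p ∈ fccStacking 1 (Real.sqrt (2 / 3)) ∧ -(2 * R) ≤ ⟪p, ν⟫_ℝ ∧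
        ⟪p, ν⟫_ℝ ≤ -R ∧ ‖p‖ ^ 2 - ⟪p, ν⟫_ℝ ^ 2 ≤ ρ ^ 2)) →
      ∀ g : EuclideanSpace ℝ (Fin 3) ≃ₗᵢ[ℝ] EuclideanSpace ℝ (Fin 3),
      (∀ p ∈ fccStacking 1 (Real.sqrt (2 / 3)), g p ∈ fccStacking 1 (Real.sqrt (2 / 3))) →
      (∀ p ∈ fccStacking 1 (Real.sqrt (2 / 3)), g.symm p ∈ fccStacking 1 (Real.sqrt (2 / 3))) →
      Reg (g.symm ν) →
      (∀ q ∈ X \ P, ∃ K I J : ℤ, q = (1 / 3 : ℝ) • barlowPos 1 (Real.sqrt (2 / 3)) constHagg K I J) →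
      (∀ q ∈ X \ P, -R < ⟪q, ν⟫_ℝ) →
      ((((P ×ˢ (X \ P)).filter fun pq => dist pq.1 pq.2 = 1).card : ℕ) : ℝ) ≤
        contactDeficiency (X \ P) + C * ρ := by
  classical
  obtain ⟨R, C, hR, h⟩ := hT
  refine ⟨R, C, hR, fun ν hν ρ hρ X P hX hPX hP g hg hg' hreg hfilm habove => ?_⟩
  have hgi : Isometry (g.symm : EuclideanSpace ℝ (Fin 3) → EuclideanSpace ℝ (Fin 3)) := g.symm.isometry
  have hinj : Function.Injective (g.symm : EuclideanSpace ℝ (Fin 3) → EuclideanSpace ℝ (Fin 3)) :=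
    g.symm.injective
  set X' := X.image g.symm with hX'
  set P' := P.image g.symm with hP'def
  set ν' := g.symm ν with hν'
  have hsd : X' \ P' = (X \ P).image g.symm := by
    rw [hX', hP'def, image_sdiff_of_injOn hinj.injOn hPX]
  have hXp : ∀ p ∈ X', ∀ q ∈ X', p ≠ q → 1 ≤ dist p q := by
    intro p hp q hq hpq
    obtain ⟨p₀, hp₀, rfl⟩ := mem_image.1 hp
    obtain ⟨q₀, hq₀, rfl⟩ := mem_image.1 hq
    rw [hgi.dist_eq]
    exact hX p₀ hp₀ q₀ hq₀ fun e => hpq (by rw [e])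
  have hPXp : P' ⊆ X' := image_subset_image hPX
  have hinn : ∀ p, ⟪g.symm p, ν'⟫_ℝ = ⟪p, ν⟫_ℝ := fun p => by
    rw [hν', LinearIsometryEquiv.inner_map_map]
  have hνn : ‖ν'‖ = 1 := by rw [hν', LinearIsometryEquiv.norm_map, hν]
  have hPp : ∀ p, p ∈ P' ↔ (p ∈ fccStacking 1 (Real.sqrt (2 / 3)) ∧ -(2 * R) ≤ ⟪p, ν'⟫_ℝ ∧
      ⟪p, ν'⟫_ℝ ≤ -R ∧ ‖p‖ ^ 2 - ⟪p, ν'⟫_ℝ ^ 2 ≤ ρ ^ 2) := by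
    intro p
    rw [hP'def, mem_image]
    constructor
    · rintro ⟨p₀, hp₀, rfl⟩
      obtain ⟨hΛ, h1, h2, h3⟩ := (hP p₀).1 hp₀
      refine ⟨hg' p₀ hΛ, ?_, ?_, ?_⟩
      · rw [hinn]; exact h1
      · rw [hinn]; exact h2
      · rw [hinn, LinearIsometryEquiv.norm_map]; exact h3
    · rintro ⟨hΛ, h1, h2, h3⟩
      have hi : ⟪g p, ν⟫_ℝ = ⟪p, ν'⟫_ℝ := by rw [← hinn (g p), LinearIsometryEquiv.symm_apply_apply]
      refine ⟨g p, (hP (g p)).2 ⟨hg p hΛ, ?_, ?_, ?_⟩, g.symm_apply_apply p⟩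
      · rw [hi]; exact h1
      · rw [hi]; exact h2
      · rw [hi, LinearIsometryEquiv.norm_map]; exact h3
  have hfilm' : ∀ q ∈ X' \ P', ∃ K I J : ℤ, q = (1 / 3 : ℝ) • barlowPos 1 (Real.sqrt (2 / 3)) constHagg K I J := by
    intro q hq
    rw [hsd] at hq
    obtain ⟨q₀, hq₀, rfl⟩ := mem_image.1 hq
    obtain ⟨K, I, J, rfl⟩ := hfilm q₀ hq₀
    have hΛ : barlowPos 1 (Real.sqrt (2 / 3)) constHagg K I J ∈ fccStacking 1 (Real.sqrt (2 / 3)) := ⟨K, I, J, rfl⟩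
    obtain ⟨K', I', J', hK⟩ := mem_barlowStacking_iff.1 (hg' _ hΛ)
    refine ⟨K', I', J', ?_⟩
    rw [map_smul, hK]
  have habove' : ∀ q ∈ X' \ P', -R < ⟪q, ν'⟫_ℝ := by
    intro q hq
    rw [hsd] at hq
    obtain ⟨q₀, hq₀, rfl⟩ := mem_image.1 hq
    rw [hinn]; exact habove q₀ hq₀
  have hmain := h ν' hνn ρ hρ X' P' hXp hPXp hPp hreg hfilm' habove'
  rw [hsd, hP'def, card_cross_image_of_isometry hgi, contactDeficiency_image_of_isometry hgi] at hmain
  exact hmain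

/-- **Films on `(1/3)Λ₀`, every cone** (registered by name): for every lattice isometry `g` and every
unit normal `ν` with `⟪g hᵢ, ν⟫ ≤ 0` for the six heads, films in `(1/3)Λ₀` above the cut satisfy the
atom in slab form. -/
theorem fourFamilyBarlowFilm_slab_orbit :
    ∃ R C : ℝ, 1 ≤ R ∧ ∀ ν : EuclideanSpace ℝ (Fin 3), ‖ν‖ = 1 → ∀ ρ : ℝ, R ≤ ρ →
      ∀ X P : Finset (EuclideanSpace ℝ (Fin 3)),
      (∀ p ∈ X, ∀ q ∈ X, p ≠ q → 1 ≤ dist p q) → P ⊆ X →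
      (∀ p, p ∈ P ↔ (p ∈ fccStacking 1 (Real.sqrt (2 / 3)) ∧ -(2 * R) ≤ ⟪p, ν⟫_ℝ ∧
        ⟪p, ν⟫_ℝ ≤ -R ∧ ‖p‖ ^ 2 - ⟪p, ν⟫_ℝ ^ 2 ≤ ρ ^ 2)) →
      ∀ g : EuclideanSpace ℝ (Fin 3) ≃ₗᵢ[ℝ] EuclideanSpace ℝ (Fin 3),
      (∀ p ∈ fccStacking 1 (Real.sqrt (2 / 3)), g p ∈ fccStacking 1 (Real.sqrt (2 / 3))) →
      (∀ p ∈ fccStacking 1 (Real.sqrt (2 / 3)), g.symm p ∈ fccStacking 1 (Real.sqrt (2 / 3))) →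
      (∀ e ∈ ([barlowPos 1 (Real.sqrt (2 / 3)) constHagg 0 1 (-1), -barlowPos 1 (Real.sqrt (2 / 3)) constHagg 1 0 0, -barlowPos 1 (Real.sqrt (2 / 3)) constHagg 0 1 0,
      barlowPos 1 (Real.sqrt (2 / 3)) constHagg (-1) 0 1, -barlowPos 1 (Real.sqrt (2 / 3)) constHagg 0 0 1, barlowPos 1 (Real.sqrt (2 / 3)) constHagg (-1) 1 0] : List (EuclideanSpace ℝ (Fin 3))), ⟪g e, ν⟫_ℝ ≤ 0) →
      (∀ q ∈ X \ P, ∃ K I J : ℤ, q = (1 / 3 : ℝ) • barlowPos 1 (Real.sqrt (2 / 3)) constHagg K I J) →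
      (∀ q ∈ X \ P, -R < ⟪q, ν⟫_ℝ) →
      ((((P ×ˢ (X \ P)).filter fun pq => dist pq.1 pq.2 = 1).card : ℕ) : ℝ) ≤
        contactDeficiency (X \ P) + C * ρ := by
  classical
  have hT := fourFamily_transport
    (fun ν => ∀ e ∈ ([barlowPos 1 (Real.sqrt (2 / 3)) constHagg 0 1 (-1), -barlowPos 1 (Real.sqrt (2 / 3)) constHagg 1 0 0, -barlowPos 1 (Real.sqrt (2 / 3)) constHagg 0 1 0,
      barlowPos 1 (Real.sqrt (2 / 3)) constHagg (-1) 0 1, -barlowPos 1 (Real.sqrt (2 / 3)) constHagg 0 0 1, barlowPos 1 (Real.sqrt (2 / 3)) constHagg (-1) 1 0] : List (EuclideanSpace ℝ (Fin 3))), ⟪e, ν⟫_ℝ ≤ 0)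
    fourFamilyBarlowFilm_slab
  obtain ⟨R, C, hR, h⟩ := hT
  refine ⟨R, C, hR, fun ν hν ρ hρ X P hX hPX hP g hg hg' hcone => h ν hν ρ hρ X P hX hPX hP g hg hg' ?_⟩
  intro e he
  rw [← g.inner_map_map, LinearIsometryEquiv.apply_symm_apply]
  exact hcone e he

end Summit.Ventures.Crystal3D.Theorems

end
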